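import Summits.ResolutionOfSingularities.ResolutionOfSingularities.Theorems.EquisingularLiftDefs
import Summits.ResolutionOfSingularities.ResolutionOfSingularities.Theorems.EquisingularLiftEquisingularLiftSplit
import Summits.ResolutionOfSingularities.ResolutionOfSingularities.Theorems.EquisingularLiftEquisingularLiftChainRegular
import Summits.ResolutionOfSingularities.ResolutionOfSingularities.Theorems.EquisingularLiftEquisingularLiftSmoothNhdOfGoodAt
import Summits.ResolutionOfSingularities.ResolutionOfSingularities.Theorems.EquisingularLiftEquisingularLiftSectionOfSmooth
import Summits.ResolutionOfSingularities.ResolutionOfSingularities.Theorems.EquisingularLiftEquisingularLiftPointOfIsClosed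
import Summits.ResolutionOfSingularities.ResolutionOfSingularities.Theorems.EquisingularLiftEquisingularLiftGoodAtOverIso
import Summits.ResolutionOfSingularities.ResolutionOfSingularities.Theorems.EquisingularLiftEquisingularLiftReducedStalkOverIso
import Summits.ResolutionOfSingularities.ResolutionOfSingularities.Theorems.EquisingularLiftEquisingularLiftSectionKer
import Summits.ResolutionOfSingularities.ResolutionOfSingularities.Theorems.EquisingularLiftEquisingularLiftSectionBlowupIrreducible
import Summits.ResolutionOfSingularities.ResolutionOfSingularities.Theorems.EquisingularLiftEquisingularLiftSectionBlowupGoodAt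
import Summits.ResolutionOfSingularities.ResolutionOfSingularities.Theorems.EquisingularLiftEquisingularLiftSectionBlowupCurveDelta
import Summits.ResolutionOfSingularities.ResolutionOfSingularities.Theorems.EquisingularLiftEquisingularLiftIntegralFlatOfGoodAt
import Literature.AlgebraicGeometry.Resolution.BlowupsExistence
import Literature.AlgebraicGeometry.Resolution.BlowupsProperProofs
import Literature.AlgebraicGeometry.Resolution.ResolutionGlue
import Literature.AlgebraicGeometry.Resolution.ComponentGluing
import Literature.AlgebraicGeometry.Resolution.QuasiExcellentCurveDelta
import Literature.AlgebraicGeometry.Resolution.AlterationsCurves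
import Literature.AlgebraicGeometry.Resolution.RegularLocusDense
import Literature.AlgebraicGeometry.Resolution.Temkin2008Localization
import HarnessLib

/-!
# `EquisingularLift`, line `strata-split` — `stub_resolveOnePoint_dimOne` (the CURVE case of child 2)

Registered skeleton stub (v4) of the crux `stmt-ResolutionOfSingularities-15660`: liftable embedded resolution of ONE
non-regular point `x₀` of the reduced iterated strict transform `Γ₁ = V(closure S₁)` when `dim Γ₁ ≤ 1`, by finitely many
blow-ups of the ambient along Hensel SECTIONS through the non-regular points over `x₀`.

Proof (classical embedded resolution of curve singularities by point blow-ups, here by SECTION blow-ups of the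
mixed-characteristic ambient): well-founded induction on the total `δ`-invariant `∑ᶠ_y δ(𝒪_{Γ',y})` of the current reduced
strict transform `Γ'`. A stage `(X', σ', S')` over `P₁` carries: the chain, irreducible special fibre, an open
`V ⊇ Γ₁ ∖ {x₀}` over which `σ'` is an isomorphism, GOOD REDUCTION of the ambient at every point over `x₀`, and
`dim Γ' ≤ 1`. If some point `z₁` of `Γ'` over `x₀` is non-regular: good reduction gives a smooth neighbourhood
(`exists_smooth_nhd_of_goodAt`), `z₁` is closed hence `κ`-rational (`exists_point_of_isClosed`), Hensel gives a section `s`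
through it (`exists_section_of_smooth`); blow up `s.ker` (`exists_isBlowup`): the chain extends (centre `≅ Spec O` regular,
`SectionKer`; its image meets `closure S₁` only in `x₀`), the special fibre stays irreducible
(`isIrreducible_specialFibre_of_isBlowup_section`), good reduction persists over `x₀` (`goodAt_of_isBlowup_section`,
`stub_goodAtOverIso`), `V` shrinks by the closed image of the centre, and the new reduced strict transform is the point
blow-up of the curve, so `dim ≤ 1` and the total `δ` DROPS (`curveBlowup_of_isBlowup_section`). Otherwise the stage is the
answer.
-/

set_option linter.dupNamespace false -- mandated namespace `Summit.<Summit>.<Problem>` of this single-conjunct summit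
set_option linter.overlappingInstances false -- registered signature carries `[IsDomain O] [IsDiscreteValuationRing O]`

noncomputable section

open CategoryTheory AlgebraicGeometry TopologicalSpace Topology
open Literature.AlgebraicGeometry.Resolution
open AlgebraicGeometry.Scheme.IdealSheafData
open Summit.ResolutionOfSingularities.ResolutionOfSingularities.Theses.EquisingularLift.Split

namespace Summit.ResolutionOfSingularities.ResolutionOfSingularities.Cruxes.EquisingularLift.StrataSplit

/-! ## Small lemmas -/

/-- Over a locally Noetherian base, locally of finite type implies locally of finite presentation. [folklore] -/
theorem locallyOfFinitePresentation_of_isLocallyNoetherian' {X Y : Scheme.{0}} (g : X ⟶ Y)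
    [IsLocallyNoetherian Y] [LocallyOfFiniteType g] : LocallyOfFinitePresentation g := by
  rw [HasRingHomProperty.iff_appLE (P := @LocallyOfFinitePresentation)]
  intro U V e
  haveI := IsLocallyNoetherian.component_noetherian (X := Y) U
  exact RingHom.FinitePresentation.of_finiteType.mp
    (HasRingHomProperty.appLE @LocallyOfFiniteType g inferInstance U V e)

/-- Along a chain starting at a closed `Y` inside the special fibre, every strict transform stays inside the special
fibre: `closure S' ⊆ (σ' ≫ r)⁻¹{s}`. [folklore] -/
theorem closure_subset_preimage_of_chain {O : Type} [CommRing O] [IsLocalRing O] {P : Scheme.{0}}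
    (r : P ⟶ Spec (.of O)) {Y : Set P} (hYirr : IsIrreducible Y) (hYcl : IsClosed Y)
    (hY : Y ⊆ r ⁻¹' {IsLocalRing.closedPoint O}) {P' : Scheme.{0}} {σ : P' ⟶ P} {S' : Set P'}
    (hch : Chain P Y P' σ S') : closure S' ⊆ (σ ≫ r) ⁻¹' {IsLocalRing.closedPoint O} := by
  obtain ⟨ξ, hξ⟩ : ∃ ξ : P, IsGenericPoint ξ Y := QuasiSober.sober hYirr hYcl
  obtain ⟨ξ', hfib, hS'⟩ := Chain.fibre hch hξ
  have hσξ' : σ ξ' = ξ := by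
    have : ξ' ∈ σ ⁻¹' {ξ} := by rw [hfib]; rfl
    simpa using this
  have hcl : IsClosed ((σ ≫ r) ⁻¹' {IsLocalRing.closedPoint O}) :=
    (IsLocalRing.isClosed_singleton_closedPoint O).preimage (σ ≫ r).continuous
  rw [hS', closure_closure]
  refine closure_minimal (Set.singleton_subset_iff.mpr ?_) hcl
  show (σ ≫ r) ξ' ∈ ({IsLocalRing.closedPoint O} : Set _)
  rw [Scheme.Hom.comp_apply, hσξ']
  exact hY hξ.mem

/-- The generic point of the reduced closed subscheme on an irreducible closed set has a regular (field) stalk; hence a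
non-regular point is not the generic point of the underlying set. [folklore] -/
theorem not_isGenericPoint_of_not_isRegularLocalRing {X : Scheme.{0}} (Z : Closeds X)
    (hZ : IsIrreducible (Z : Set X)) (z : (vanishingIdeal Z).subscheme)
    (hz : ¬ IsRegularLocalRing ((vanishingIdeal Z).subscheme.presheaf.stalk z)) :
    ¬ IsGenericPoint ((vanishingIdeal Z).subschemeι z : X) (Z : Set X) := by
  haveI : IsIntegral (vanishingIdeal Z).subscheme := ComponentGluing.isIntegral_subscheme_vanishingIdeal Z hZ
  intro hgen
  apply hz
  -- `z` is the generic point of the integral scheme `V(Z)`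
  have hz' : z = genericPoint (vanishingIdeal Z).subscheme := by
    apply (vanishingIdeal Z).subschemeι.isClosedEmbedding.injective
    apply IsGenericPoint.eq (S := (Z : Set X)) hgen
    have h := (genericPoint_spec (vanishingIdeal Z).subscheme).image (vanishingIdeal Z).subschemeι.continuous
    rwa [Set.image_univ, (vanishingIdeal Z).subschemeι.isClosedEmbedding.isClosed_range.closure_eq,
      range_subschemeι, coe_support_vanishingIdeal] at h
  rw [hz']
  exact genericPoint_mem_regularLocus _

/-- Non-regular points of an integral Noetherian quasi-excellent scheme of dimension `≤ 1` are closed points.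
[folklore] -/
theorem isClosed_singleton_of_not_isRegularLocalRing {C : Scheme.{0}} [IsIntegral C] [IsNoetherian C]
    (hC : Scheme.IsQuasiExcellent C) (hdim : topologicalKrullDim C ≤ 1) (z : C)
    (hz : ¬ IsRegularLocalRing (C.presheaf.stalk z)) : IsClosed ({z} : Set C) := by
  have hclosed : IsClosed (Scheme.regularLocus C)ᶜ :=
    (Scheme.isOpen_regularLocus_of_isQuasiExcellent hC).isClosed_compl
  have hne : (Scheme.regularLocus C)ᶜ ≠ Set.univ := by
    intro h
    have : genericPoint C ∈ (Scheme.regularLocus C)ᶜ := h ▸ Set.mem_univ _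
    exact this (genericPoint_mem_regularLocus C)
  exact (Set.finite_and_isClosed_singleton_of_dim_le_one hdim hclosed hne).2 z hz


/-! ## The stub -/

/-- `stub_resolveOnePoint_dimOne` with one extra conclusion recorded for the curve-case assembly: the new reduced strict
transform is again of dimension `≤ 1`. Liftable embedded resolution of ONE non-regular point of a CURVE inside the special
fibre, by finitely many blow-ups of the ambient along Hensel sections (well-founded induction on the total `δ`-invariant; see
the module docstring). [folklore; Kollár 2007 §1.4 for the `δ`-drop, Liu 2002 §8.1 for blow-ups along sections] -/
theorem resolveOnePoint_dimOne_dim : ∀ (O : Type) [CommRing O] [IsDomain O] [IsDiscreteValuationRing O] [CharZero O] [IsAdicComplete (IsLocalRing.maximalIdeal O) O] [IsAlgClosed (IsLocalRing.ResidueField O)] (P P₁ : AlgebraicGeometry.Scheme.{0}) (q : P ⟶ AlgebraicGeometry.Spec (.of O)) (Y : TopologicalSpace.Closeds P) (σ₁ : P₁ ⟶ P) (S₁ : Set P₁), AlgebraicGeometry.Smooth q → AlgebraicGeometry.IsProper q → (Y : Set P) ⊆ q ⁻¹' {IsLocalRing.closedPoint O} → IsIrreducible (Y : Set P) → Chain P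 (Y : Set P) P₁ σ₁ S₁ → IsIrreducible (((CategoryTheory.CategoryStruct.comp σ₁ q)) ⁻¹' {IsLocalRing.closedPoint O}) → (singSet S₁).Finite → GoodSet ((CategoryTheory.CategoryStruct.comp σ₁ q)) S₁ → topologicalKrullDim ↥(AlgebraicGeometry.Scheme.IdealSheafData.vanishingIdeal (⟨closure S₁, isClosed_closure⟩ : TopologicalSpace.Closeds P₁)).subscheme ≤ 1 → ∀ x₀ ∈ singSet S₁, ∃ (P₂ : AlgebraicGeometry.Scheme.{0}) (σ₂ : P₂ ⟶ P₁) (S₂ : Set P₂), topologicalKrullDim ↥(AlgebraicGeometry.Scheme.IdealSheafData.vanishingIdeal (⟨closure S₂, isClosed_closure⟩ : TopologicalSpace.Closeds P₂)).subscheme ≤ 1 ∧ Chain P₁ (closure S₁) P₂ σ₂ S₂ ∧ IsIrreducible (((CategoryTheory.CategoryStruct.comp (CategoryTheory.CategoryStruct.comp σ₂ σ₁) q)) ⁻¹' {IsLocalRing.closedPoint O}) ∧ ∃ V : P₁.Opens, (∀ x : ↥(AlgebraicGeometry.Scheme.IdealSheafData.vanishingIdeal (⟨closure S₁, isClosed_closure⟩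 : TopologicalSpace.Closeds P₁)).subscheme, x ≠ x₀ → ((AlgebraicGeometry.Scheme.IdealSheafData.vanishingIdeal (⟨closure S₁, isClosed_closure⟩ : TopologicalSpace.Closeds P₁)).subschemeι x : P₁) ∈ V) ∧ CategoryTheory.IsIso (σ₂ ∣_ V) ∧ (∀ z : ↥(AlgebraicGeometry.Scheme.IdealSheafData.vanishingIdeal (⟨closure S₂, isClosed_closure⟩ : TopologicalSpace.Closeds P₂)).subscheme, (σ₂ ((AlgebraicGeometry.Scheme.IdealSheafData.vanishingIdeal (⟨closure S₂, isClosed_closure⟩ : TopologicalSpace.Closeds P₂)).subschemeι z) : P₁) = (AlgebraicGeometry.Scheme.IdealSheafData.vanishingIdeal (⟨closure S₁, isClosed_closure⟩ : TopologicalSpace.Closeds P₁)).subschemeι x₀ → IsRegularLocalRing ((AlgebraicGeometry.Scheme.IdealSheafData.vanishingIdeal (⟨closure S₂, isClosed_closure⟩ : TopologicalSpace.Closeds P₂)).subscheme.presheaf.stalk z)) := by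
  classical
  intro O _ _ _ _ _ _ P P₁ q Y σ₁ S₁ hq hqp hY hYirr hch₁ hirr₁ _ hgood₁ hdim x₀ hx₀
  -- ambient facts
  haveI := hq
  haveI := hqp
  have hPnoeth : IsLocallyNoetherian P := LocallyOfFiniteType.isLocallyNoetherian q
  have hPreg : Scheme.IsRegular P := fun x => (stub_goodAtOfSmooth O P q hq x).1
  obtain ⟨hP₁noeth, hP₁reg, hσ₁⟩ := chain_isRegular P (Y : Set P) P₁ σ₁ S₁ hch₁ hPnoeth hPreg
  haveI := hP₁noeth
  haveI := hσ₁
  set r₁ : P₁ ⟶ Spec (.of O) := σ₁ ≫ q with hr₁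
  haveI : IsProper r₁ := inferInstance
  set s₀ := IsLocalRing.closedPoint O with hs₀def
  -- the closed irreducible set `closure S₁` and its reduced subscheme `Γ₁`
  have hTsub : closure S₁ ⊆ r₁ ⁻¹' {s₀} := closure_subset_preimage_of_chain q hYirr Y.isClosed hY hch₁
  obtain ⟨ξ, hξ⟩ : ∃ ξ : P, IsGenericPoint ξ (Y : Set P) := QuasiSober.sober hYirr Y.isClosed
  obtain ⟨ξ₁, -, hS₁⟩ := Chain.fibre hch₁ hξ
  have hTirr : IsIrreducible (closure S₁) := by
    rw [hS₁, closure_closure]; exact isIrreducible_singleton.closure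
  have hclS₁ : closure S₁ = S₁ := by rw [hS₁, closure_closure]
  haveI hΓ₁int : IsIntegral (vanishingIdeal (⟨closure S₁, isClosed_closure⟩ : Closeds P₁)).subscheme :=
    ComponentGluing.isIntegral_subscheme_vanishingIdeal _ hTirr
  obtain ⟨p₀, hp₀⟩ : ∃ p₀ : P₁, p₀ = (vanishingIdeal (⟨closure S₁, isClosed_closure⟩ : Closeds P₁)).subschemeι x₀ :=
    ⟨_, rfl⟩
  have hrange₁ : Set.range (vanishingIdeal (⟨closure S₁, isClosed_closure⟩ : Closeds P₁)).subschemeι = closure S₁ := by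
    rw [range_subschemeι, coe_support_vanishingIdeal]; rfl
  have hp₀T : p₀ ∈ closure S₁ := by rw [hp₀]; exact (Set.ext_iff.mp hrange₁ _).mp (Set.mem_range_self x₀)
  have hp₀s : r₁ p₀ = s₀ := hTsub hp₀T
  have hp₀gen : ¬ IsGenericPoint p₀ (closure S₁) := by
    rw [hp₀]
    exact not_isGenericPoint_of_not_isRegularLocalRing (⟨closure S₁, isClosed_closure⟩ : Closeds P₁) hTirr x₀ hx₀
  -- THE INDUCTION on the total `δ`-invariant of the current reduced strict transform
  suffices key : ∀ (n : ℕ∞) (X' : Scheme.{0}) (σ' : X' ⟶ P₁) (S' : Set X')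
      [IsIntegral (vanishingIdeal (⟨closure S', isClosed_closure⟩ : Closeds X')).subscheme],
      Chain P₁ (closure S₁) X' σ' S' →
      IsIrreducible ((σ' ≫ r₁) ⁻¹' {s₀}) →
      (∃ V : P₁.Opens, (∀ x : ↥(vanishingIdeal (⟨closure S₁, isClosed_closure⟩ : Closeds P₁)).subscheme, x ≠ x₀ →
          ((vanishingIdeal (⟨closure S₁, isClosed_closure⟩ : Closeds P₁)).subschemeι x : P₁) ∈ V) ∧ IsIso (σ' ∣_ V)) →
      (∀ w : X', σ' w = p₀ → GoodAt (σ' ≫ r₁) w) →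
      topologicalKrullDim ↥(vanishingIdeal (⟨closure S', isClosed_closure⟩ : Closeds X')).subscheme ≤ 1 →
      ∑ᶠ y : ↥(vanishingIdeal (⟨closure S', isClosed_closure⟩ : Closeds X')).subscheme,
        pointDelta (vanishingIdeal (⟨closure S', isClosed_closure⟩ : Closeds X')).subscheme y = n →
      ∃ (P₂ : Scheme.{0}) (σ₂ : P₂ ⟶ P₁) (S₂ : Set P₂),
        topologicalKrullDim ↥(vanishingIdeal (⟨closure S₂, isClosed_closure⟩ : Closeds P₂)).subscheme ≤ 1 ∧
        Chain P₁ (closure S₁) P₂ σ₂ S₂ ∧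
        IsIrreducible (((σ₂ ≫ σ₁) ≫ q) ⁻¹' {s₀}) ∧
        ∃ V : P₁.Opens, (∀ x : ↥(vanishingIdeal (⟨closure S₁, isClosed_closure⟩ : Closeds P₁)).subscheme, x ≠ x₀ →
          ((vanishingIdeal (⟨closure S₁, isClosed_closure⟩ : Closeds P₁)).subschemeι x : P₁) ∈ V) ∧ IsIso (σ₂ ∣_ V) ∧
          ∀ z : ↥(vanishingIdeal (⟨closure S₂, isClosed_closure⟩ : Closeds P₂)).subscheme,
            (σ₂ ((vanishingIdeal (⟨closure S₂, isClosed_closure⟩ : Closeds P₂)).subschemeι z) : P₁) = p₀ →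
            IsRegularLocalRing ((vanishingIdeal (⟨closure S₂, isClosed_closure⟩ : Closeds P₂)).subscheme.presheaf.stalk z) by
    -- the base stage `(P₁, 𝟙, S₁)`
    have hbase := key _ P₁ (𝟙 P₁) S₁ (fun Q h0 _ => by rwa [hclS₁] at h0)
      (by simpa only [Category.id_comp] using hirr₁)
      ⟨⊤, fun x _ => trivial, inferInstance⟩
      (fun w hw => by
        have hw' : w = p₀ := by simpa using hw
        rw [Category.id_comp, hw', hp₀]; exact hgood₁ x₀ hx₀) hdim rfl
    simpa only [hp₀] using hbase
  intro n
  induction n using WellFoundedLT.induction with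
  | ind n ih =>
  intro X' σ' S' hI' hchain hirr hV hgoodAt hdim' hM
  -- facts about the stage
  obtain ⟨hnoeth', hreg', hpropσ'⟩ := chain_isRegular P₁ (closure S₁) X' σ' S' hchain hP₁noeth hP₁reg
  haveI := hnoeth'
  haveI := hpropσ'
  set r' : X' ⟶ Spec (.of O) := σ' ≫ r₁ with hr'
  haveI : IsProper r' := inferInstance
  by_cases hbad : ∃ z : ↥(vanishingIdeal (⟨closure S', isClosed_closure⟩ : Closeds X')).subscheme,
      σ' ((vanishingIdeal (⟨closure S', isClosed_closure⟩ : Closeds X')).subschemeι z) = p₀ ∧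
      ¬ IsRegularLocalRing ((vanishingIdeal (⟨closure S', isClosed_closure⟩ : Closeds X')).subscheme.presheaf.stalk z)
  swap
  · -- EXIT: no non-regular point over `x₀` is left
    obtain ⟨V, hVx, hiso⟩ := hV
    refine ⟨X', σ', S', hdim', hchain, by simpa only [Category.assoc] using hirr, V, hVx, hiso, fun z hz => ?_⟩
    by_contra h
    exact hbad ⟨z, hz, h⟩
  -- STEP: blow up a section through a non-regular point `z₁` over `x₀`
  obtain ⟨z₁, hz₁, hz₁reg⟩ := hbad
  obtain ⟨V, hVx, hiso⟩ := hV
  -- (s1) the stage is integral and flat over `O`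
  set w₁ : X' := (vanishingIdeal (⟨closure S', isClosed_closure⟩ : Closeds X')).subschemeι z₁ with hw₁
  have hr'w₁ : r' w₁ = s₀ := by
    show (σ' ≫ r₁) w₁ = s₀
    rw [Scheme.Hom.comp_apply, hz₁, hp₀s]
  have hga : GoodAt r' w₁ := hgoodAt w₁ hz₁
  obtain ⟨hint', hflat', -⟩ := isIntegral_and_flat_of_goodAt O X' r' hnoeth' hreg' hirr ⟨w₁, hr'w₁, hga⟩
  haveI := hint'
  -- (s2) a smooth neighbourhood of `w₁`
  haveI : LocallyOfFinitePresentation r' := locallyOfFinitePresentation_of_isLocallyNoetherian' r'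
  obtain ⟨U, hw₁U, hU⟩ := exists_smooth_nhd_of_goodAt O X' r' inferInstance hflat' w₁ hr'w₁ hga
  -- (s3) `S'` is closed irreducible inside the special fibre; `w₁` is a closed point
  obtain ⟨ξT, hξT⟩ : ∃ ξT : P₁, IsGenericPoint ξT (closure S₁) := QuasiSober.sober hTirr isClosed_closure
  obtain ⟨ξ', hfib', hS'⟩ := Chain.fibre hchain hξT
  have hS'cl : IsClosed S' := by rw [hS']; exact isClosed_closure
  have hclS' : closure S' = S' := hS'cl.closure_eq
  have hS'irr : IsIrreducible (closure S') := by
    rw [hS', closure_closure]; exact isIrreducible_singleton.closure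
  have hS'sub : closure S' ⊆ r' ⁻¹' {s₀} :=
    closure_subset_preimage_of_chain r₁ hTirr isClosed_closure hTsub hchain
  have hrange' : Set.range (vanishingIdeal (⟨closure S', isClosed_closure⟩ : Closeds X')).subschemeι = closure S' := by
    rw [range_subschemeι, coe_support_vanishingIdeal]; rfl
  have hw₁gen : ¬ IsGenericPoint w₁ (closure S') :=
    not_isGenericPoint_of_not_isRegularLocalRing (⟨closure S', isClosed_closure⟩ : Closeds X') hS'irr z₁ hz₁reg
  haveI : CompactSpace X' := QuasiCompact.compactSpace_of_compactSpace r'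
  haveI : IsNoetherian X' := ⟨⟩
  haveI : IsNoetherian (vanishingIdeal (⟨closure S', isClosed_closure⟩ : Closeds X')).subscheme :=
    isNoetherian_of_isClosedImmersion (vanishingIdeal (⟨closure S', isClosed_closure⟩ : Closeds X')).subschemeι
  have hqe' : Scheme.IsQuasiExcellent (vanishingIdeal (⟨closure S', isClosed_closure⟩ : Closeds X')).subscheme := by
    haveI : IsReduced (vanishingIdeal (⟨closure S', isClosed_closure⟩ : Closeds X')).subscheme := inferInstance
    refine isQuasiExcellent_of_range_subset_closedPoint
      ((vanishingIdeal (⟨closure S', isClosed_closure⟩ : Closeds X')).subschemeι ≫ r') ?_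
    rintro _ ⟨y, rfl⟩
    rw [Scheme.Hom.comp_apply]
    exact hS'sub ((Set.ext_iff.mp hrange' _).mp (Set.mem_range_self y))
  have hz₁cl : IsClosed ({z₁} : Set (vanishingIdeal (⟨closure S', isClosed_closure⟩ : Closeds X')).subscheme) :=
    isClosed_singleton_of_not_isRegularLocalRing hqe' hdim' z₁ hz₁reg
  have hw₁cl : IsClosed ({w₁} : Set X') := by
    have h := (vanishingIdeal (⟨closure S', isClosed_closure⟩ : Closeds X')).subschemeι.isClosedEmbedding.isClosedMap
      _ hz₁cl
    rwa [Set.image_singleton] at h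
  -- (s4) a `κ`-point at `w₁` and a section through it (Hensel)
  obtain ⟨xpt, hxr, hxrange⟩ := exists_point_of_isClosed O X' r' inferInstance w₁ hw₁cl hr'w₁
  obtain ⟨s, hs, hsx⟩ := exists_section_of_smooth O X' r' U hU xpt
    (by rw [hxrange]; exact Set.singleton_subset_iff.mpr hw₁U) hxr
  have hs₀ : s s₀ = w₁ := by
    haveI : IsLocalHom (CommRingCat.ofHom (IsLocalRing.residue O)).hom :=
      inferInstanceAs (IsLocalHom (IsLocalRing.residue O))
    have h1 : Spec.map (CommRingCat.ofHom (IsLocalRing.residue O))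
        (IsLocalRing.closedPoint (IsLocalRing.ResidueField O)) = s₀ := AlgebraicGeometry.Spec_closedPoint
    have h2 : s s₀ = xpt (IsLocalRing.closedPoint (IsLocalRing.ResidueField O)) := by
      rw [← h1, ← Scheme.Hom.comp_apply, hsx]
    rw [h2]
    exact (Set.ext_iff.mp hxrange _).mp (Set.mem_range_self _)
  have hsU : s s₀ ∈ U := hs₀ ▸ hw₁U
  -- points of the section: `r' (s t) = t`
  have hrs : ∀ t : Spec (.of O), r' (s t) = t := fun t => by
    rw [← Scheme.Hom.comp_apply, hs]; rfl
  -- (s5) the centre `C = s.ker`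
  obtain ⟨_, hCreg, -, hCsupp⟩ := section_isClosedImmersion_and_isRegular_ker O X' r' s hs
  have hCspecial : ∀ c ∈ (s.ker.support : Set X'), r' c = s₀ → c = w₁ := by
    intro c hc hcs
    rw [hCsupp] at hc
    obtain ⟨t, rfl⟩ := hc
    rw [hrs] at hcs
    rw [hcs, hs₀]
  have hξ'mem : ξ' ∈ closure S' := by rw [hS', closure_closure]; exact subset_closure rfl
  have hξ'gen : IsGenericPoint ξ' (closure S') := by
    rw [isGenericPoint_def, hS', closure_closure]
  have hξ'C : ξ' ∉ (s.ker.support : Set X') := fun h =>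
    hw₁gen (hCspecial ξ' h (hS'sub hξ'mem) ▸ hξ'gen)
  have hCne : s.ker ≠ ⊥ := by
    intro h
    apply hξ'C
    rw [h, Scheme.IdealSheafData.support_bot]
    trivial
  have hnotsub : ¬ closure S' ⊆ (s.ker.support : Set X') := fun h => hξ'C (h hξ'mem)
  -- (s6) blow up
  obtain ⟨X'', τ, hτ⟩ := exists_isBlowup X' s.ker
  haveI : IsProper τ := hτ.isProper
  have hnoeth'' : IsLocallyNoetherian X'' := LocallyOfFiniteType.isLocallyNoetherian τ
  -- (s7) the extended chain
  have hT : σ' '' (s.ker.support : Set X') ⊆ {x : P₁ | ¬ IsGenericPoint x (closure S₁)} := by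
    rintro _ ⟨c, hc, rfl⟩ hgen
    have hcs : r' c = s₀ := by
      show (σ' ≫ r₁) c = s₀
      rw [Scheme.Hom.comp_apply]
      exact hTsub hgen.mem
    have hc' := hCspecial c hc hcs
    rw [hc', hz₁] at hgen
    exact hp₀gen hgen
  have hchain'' : Chain P₁ (closure S₁) X'' (τ ≫ σ') (closure (τ ⁻¹' (S' \ (s.ker.support : Set X')))) :=
    fun Q h0 hstep => hstep X' X'' σ' S' s.ker τ (hchain Q h0 hstep) hτ hCreg hT
  -- (s8) the special fibre stays irreducible
  have hirr'' : IsIrreducible (((τ ≫ σ') ≫ r₁) ⁻¹' {s₀}) := by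
    rw [Category.assoc]
    exact isIrreducible_specialFibre_of_isBlowup_section O X' X'' r' U hU s hs hsU hCne τ hτ hirr
  -- (s9) the open `V''` over which the new chain is an isomorphism
  have hclosed : IsClosed (σ' '' (s.ker.support : Set X')) := σ'.isClosedMap _ s.ker.support.isClosed
  let V'' : P₁.Opens := V ⊓ ⟨(σ' '' (s.ker.support : Set X'))ᶜ, hclosed.isOpen_compl⟩
  have hV''V : V'' ≤ V := inf_le_left
  have hV''x : ∀ x : ↥(vanishingIdeal (⟨closure S₁, isClosed_closure⟩ : Closeds P₁)).subscheme, x ≠ x₀ →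
      ((vanishingIdeal (⟨closure S₁, isClosed_closure⟩ : Closeds P₁)).subschemeι x : P₁) ∈ V'' := by
    intro x hx
    refine ⟨hVx x hx, ?_⟩
    rintro ⟨c, hc, hce⟩
    have hxT : ((vanishingIdeal (⟨closure S₁, isClosed_closure⟩ : Closeds P₁)).subschemeι x : P₁) ∈ closure S₁ :=
      (Set.ext_iff.mp hrange₁ _).mp (Set.mem_range_self x)
    have hcs : r' c = s₀ := by
      show (σ' ≫ r₁) c = s₀
      rw [Scheme.Hom.comp_apply, hce]
      exact hTsub hxT
    have hc' := hCspecial c hc hcs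
    rw [hc', hz₁, hp₀] at hce
    exact hx ((vanishingIdeal (⟨closure S₁, isClosed_closure⟩ : Closeds P₁)).subschemeι.isClosedEmbedding.injective
      hce).symm
  let Wc : X'.Opens := ⟨(s.ker.support : Set X')ᶜ, s.ker.support.isClosed.isOpen_compl⟩
  have hWc : IsIso (τ ∣_ Wc) := hτ.isIso_morphismRestrict disjoint_compl_left
  have hle : (Opens.map σ'.base).obj V'' ≤ Wc := fun x hx hxC => hx.2 ⟨x, hxC, rfl⟩
  have hiso'' : IsIso ((τ ≫ σ') ∣_ V'') := by
    rw [morphismRestrict_comp]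
    have i1 := isIso_morphismRestrict_of_le σ' hiso hV''V
    have i2 := isIso_morphismRestrict_of_le τ hWc hle
    exact @IsIso.comp_isIso _ _ _ _ _ _ _ i2 i1
  -- (s10) good reduction at every point over `x₀`
  have hgoodAt'' : ∀ w : X'', (τ ≫ σ') w = p₀ → GoodAt ((τ ≫ σ') ≫ r₁) w := by
    intro w hw
    rw [Scheme.Hom.comp_apply] at hw
    rw [Category.assoc]
    by_cases hC : τ w ∈ (s.ker.support : Set X')
    · have hcs : r' (τ w) = s₀ := by
        show (σ' ≫ r₁) (τ w) = s₀
        rw [Scheme.Hom.comp_apply, hw, hp₀s]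
      have hc' : τ w = s s₀ := (hCspecial _ hC hcs).trans hs₀.symm
      exact goodAt_of_isBlowup_section O X' X'' r' U hU s hs hsU τ hτ w hc'
    · exact (stub_goodAtOverIso X' X'' τ Wc hWc w (τ w) rfl hC O r').mpr (hgoodAt (τ w) hw)
  -- (s11) the new reduced strict transform is the point blow-up of the curve: `dim ≤ 1` and the total `δ` drops
  set S'' : Set X'' := closure (τ ⁻¹' (S' \ (s.ker.support : Set X'))) with hS''def
  obtain ⟨ξ'', -, hS''⟩ := Chain.fibre hchain'' hξT
  have hS''cl : closure S'' = S'' := by rw [hS'', closure_closure]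
  have hS''irr : IsIrreducible (closure S'') := by
    rw [hS'', closure_closure]; exact isIrreducible_singleton.closure
  haveI hI'' : IsIntegral (vanishingIdeal (⟨closure S'', isClosed_closure⟩ : Closeds X'')).subscheme :=
    ComponentGluing.isIntegral_subscheme_vanishingIdeal _ hS''irr
  have e1 : closure (τ ⁻¹' (closure S' \ (s.ker.support : Set X'))) = closure S'' := by
    rw [hclS', hS''cl]
  have e2 : (⟨closure (τ ⁻¹' (closure S' \ (s.ker.support : Set X'))), isClosed_closure⟩ : Closeds X'') =
      ⟨closure S'', isClosed_closure⟩ := TopologicalSpace.Closeds.ext e1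
  have L : ∀ [IsIntegral (vanishingIdeal (⟨closure (τ ⁻¹' (closure S' \ (s.ker.support : Set X'))),
      isClosed_closure⟩ : Closeds X'')).subscheme],
      topologicalKrullDim ↥(vanishingIdeal (⟨closure (τ ⁻¹' (closure S' \ (s.ker.support : Set X'))),
        isClosed_closure⟩ : Closeds X'')).subscheme ≤ 1 ∧
      ∑ᶠ y : ↥(vanishingIdeal (⟨closure (τ ⁻¹' (closure S' \ (s.ker.support : Set X'))),
          isClosed_closure⟩ : Closeds X'')).subscheme,
        pointDelta (vanishingIdeal (⟨closure (τ ⁻¹' (closure S' \ (s.ker.support : Set X'))),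
          isClosed_closure⟩ : Closeds X'')).subscheme y <
      ∑ᶠ y : ↥(vanishingIdeal (⟨closure S', isClosed_closure⟩ : Closeds X')).subscheme,
        pointDelta (vanishingIdeal (⟨closure S', isClosed_closure⟩ : Closeds X')).subscheme y := by
    intro hinst
    have h := curveBlowup_of_isBlowup_section O X' X'' r' s hs τ hτ (closure S') isClosed_closure hS'irr hS'sub
      hnotsub z₁ hs₀.symm hz₁reg hdim'
    exact ⟨h.1, h.2.2.2.2.2⟩
  rw [e2] at L
  obtain ⟨hdim'', hlt⟩ := L
  -- (s12) induction hypothesis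
  rw [hM] at hlt
  exact ih _ hlt X'' (τ ≫ σ') S'' hchain'' hirr'' ⟨V'', hV''x, hiso''⟩ hgoodAt'' hdim'' rfl

/-- **`stub_resolveOnePoint_dimOne`** (registered skeleton stub of the crux `EquisingularLift`, line `strata-split`, v4): the
heart of child 2 (`IsolatedPointDrop`) when the reduced strict transform is a CURVE — liftable embedded resolution of one
non-regular point by blow-ups of the ambient along Hensel sections (`resolveOnePoint_dimOne_dim`). [folklore] -/
theorem stub_resolveOnePoint_dimOne : ∀ (O : Type) [CommRing O] [IsDomain O] [IsDiscreteValuationRing O] [CharZero O] [IsAdicComplete (IsLocalRing.maximalIdeal O) O] [IsAlgClosed (IsLocalRing.ResidueField O)] (P P₁ : AlgebraicGeometry.Scheme.{0}) (q : P ⟶ AlgebraicGeometry.Spec (.of O)) (Y : TopologicalSpace.Closeds P) (σ₁ : P₁ ⟶ P) (S₁ : Set P₁), AlgebraicGeometry.Smooth q → AlgebraicGeometry.IsProper q → (Y : Set P) ⊆ q ⁻¹' {IsLocalRing.closedPoint O} → IsIrreducible (Y : Set P) → Chain P (Y : Set P) P₁ σ₁ S₁ → IsIrreducible (((CategoryTheory.CategoryStruct.comp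 σ₁ q)) ⁻¹' {IsLocalRing.closedPoint O}) → (singSet S₁).Finite → GoodSet ((CategoryTheory.CategoryStruct.comp σ₁ q)) S₁ → topologicalKrullDim ↥(AlgebraicGeometry.Scheme.IdealSheafData.vanishingIdeal (⟨closure S₁, isClosed_closure⟩ : TopologicalSpace.Closeds P₁)).subscheme ≤ 1 → ∀ x₀ ∈ singSet S₁, ∃ (P₂ : AlgebraicGeometry.Scheme.{0}) (σ₂ : P₂ ⟶ P₁) (S₂ : Set P₂), Chain P₁ (closure S₁) P₂ σ₂ S₂ ∧ IsIrreducible (((CategoryTheory.CategoryStruct.comp (CategoryTheory.CategoryStruct.comp σ₂ σ₁) q)) ⁻¹' {IsLocalRing.closedPoint O}) ∧ ∃ V : P₁.Opens, (∀ x : ↥(AlgebraicGeometry.Scheme.IdealSheafData.vanishingIdeal (⟨closure S₁, isClosed_closure⟩ : TopologicalSpace.Closeds P₁)).subscheme, x ≠ x₀ → ((AlgebraicGeometry.Scheme.IdealSheafData.vanishingIdeal (⟨closure S₁, isClosed_closure⟩ : TopologicalSpace.Closeds P₁)).subschemeι x : P₁) ∈ V) ∧ CategoryTheory.IsIso (σ₂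 ∣_ V) ∧ (∀ z : ↥(AlgebraicGeometry.Scheme.IdealSheafData.vanishingIdeal (⟨closure S₂, isClosed_closure⟩ : TopologicalSpace.Closeds P₂)).subscheme, (σ₂ ((AlgebraicGeometry.Scheme.IdealSheafData.vanishingIdeal (⟨closure S₂, isClosed_closure⟩ : TopologicalSpace.Closeds P₂)).subschemeι z) : P₁) = (AlgebraicGeometry.Scheme.IdealSheafData.vanishingIdeal (⟨closure S₁, isClosed_closure⟩ : TopologicalSpace.Closeds P₁)).subschemeι x₀ → IsRegularLocalRing ((AlgebraicGeometry.Scheme.IdealSheafData.vanishingIdeal (⟨closure S₂, isClosed_closure⟩ : TopologicalSpace.Closeds P₂)).subscheme.presheaf.stalk z)) := by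
  intro O _ _ _ _ _ _ P P₁ q Y σ₁ S₁ hq hqp hY hYirr hch₁ hirr₁ hfin₁ hgood₁ hdim x₀ hx₀
  obtain ⟨P₂, σ₂, S₂, -, h⟩ :=
    resolveOnePoint_dimOne_dim O P P₁ q Y σ₁ S₁ hq hqp hY hYirr hch₁ hirr₁ hfin₁ hgood₁ hdim x₀ hx₀
  exact ⟨P₂, σ₂, S₂, h⟩

end Summit.ResolutionOfSingularities.ResolutionOfSingularities.Cruxes.EquisingularLift.StrataSplit

end
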